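import Summits.CriticalPhenomena.PercolationContinuityZ3.Theorems.PercNearOneGluingNoHeavyLowerTailBlockQ9OneDangerousPort
import Summits.CriticalPhenomena.PercolationContinuityZ3.Theorems.PercNearOneGluingAdditiveGluingGoodStep24Engine
import HarnessLib

/-!
# `NoHeavyLowerTail` (stmt-CriticalPhenomena-4575) — the LAYER LEMMA for Kozma–Nitzan's (41) on a glued block
# (Theorems 4 and 5 of arXiv:2401.12397 merged and extended to arbitrary Steiner layers)

Support file (lemma factory `prim-lf-1` gen 9; `--supports stmt-CriticalPhenomena-4575`).  No definitions, no named
facts, no sorries.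

Setting (`Fin n`, weights `w`): a block `O` disjoint from the relay set `A`, observer = the glued block
(`μ_{glue_O w}`: pairs inside `O` weight `1`), `a, b ∉ O`.  Condition on the LAYER `S` = the set of vertices outside `O`
receiving an open pair from `O` (the σ-recursion of `sigmaRec_partition` / `stub_sigmaLaw` / `stub_sigmaGeometry`):
given the layer, the world is `glue_S (kill_O w)` and the block's events become the glued layer's events.

* `blockQ9_layer` — if `a` is at most as connected to `b` as every RELAY neighbour of `O` in the block-deleted graph
  `kill_O w` (Kozma–Nitzan's Lemma 5 hypothesis, used on every layer meeting `A`), and the target inequality (41) with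
  anchor `a` holds for every glued STEINER layer `S` (`S ∩ A = ∅`) in `glue_S (kill_O w)`, then (41) holds for the glued
  block:  `μ_{glue_O w}(a ↔ b, O ↔ A) ≤ μ_{glue_O w}(O ↔ b)`.
  With no Steiner neighbours this is `blockThm4_witness` (Kozma–Nitzan Thm 4 for blocks); with one Steiner neighbour it
  is the (41)-form of their Thm 5; iterating it through the Steiner layers (the layer of a layer, …) is the "layered
  certificate" of memo FROM-prim-lf-1-gen9.md: a ∈ Adm(O) :⟺ [a dominated by O's relay neighbours in kill_O w] ∧
  [∀ Steiner layer S, some a' ∈ Adm(S) in kill_O w dominates a jointly] ⟹ (41)_a for O.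
* `blockQ9_layer_transfer` — the same with the Steiner-layer hypothesis supplied for another anchor `a'` together with
  the transfer comparison `μ(a ↔ b, S ↔ A) ≤ μ(a' ↔ b, S ↔ A)` (as in `blockQ9_of_transfer`).
* `q9_layer` — the root form for a single observer vertex `o` (block `{o}`; `goodStep24_glue_singleton`).
[cite: KozmaNitzan2024, Lemma 5, Theorems 4–5 (pp. 12–14), Question 9 (p. 36)]
-/

namespace Summit.CriticalPhenomena.PercolationContinuityZ3.Theorems

open MeasureTheory Set ProbabilityTheory
open Literature.Probability.LatticeModels
open Literature.Probability.Percolation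

noncomputable section
open Classical

namespace BlockQ9

variable {n : ℕ}

/-- **Layer lemma (Kozma–Nitzan Theorems 4/5 for a glued block with arbitrary Steiner layers).**  `O` disjoint from
`A`, `a, b ∉ O`; (i) `a` is dominated in `kill_O w` by every relay receiving a positive pair from `O`; (ii) for every
nonempty relay-free layer `S` (each member outside `O` and receiving a positive pair from `O`) the inequality (41) with
anchor `a` holds for the glued layer in `glue_S (kill_O w)`.  Then `μ_{glue_O w}(a ↔ b, O ↔ A) ≤ μ_{glue_O w}(O ↔ b)`.
[cite: KozmaNitzan2024, Lemma 5 and Theorems 4–5 (pp. 12–14)] -/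
theorem blockQ9_layer (w : Sym2 (Fin n) → unitInterval) (O A : Finset (Fin n)) (a b : Fin n)
    (hOA : Disjoint O A) (haO : a ∉ O) (hbO : b ∉ O)
    (hdom : ∀ v ∈ A, (∃ o ∈ O, w s(o, v) ≠ 0) →
      (prodBernoulli (fun e : Sym2 (Fin n) => if (∃ x ∈ e, x ∈ O) then 0 else w e)).real (openConn a b) ≤
        (prodBernoulli (fun e : Sym2 (Fin n) => if (∃ x ∈ e, x ∈ O) then 0 else w e)).real (openConn v b))
    (hsteiner : ∀ S : Finset (Fin n), S.Nonempty → Disjoint S A →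
      (∀ x ∈ S, x ∉ O ∧ ∃ o ∈ O, w s(o, x) ≠ 0) →
      (prodBernoulli (fun e : Sym2 (Fin n) =>
          if (∀ x ∈ e, x ∈ S) ∧ ¬ e.IsDiag then 1 else if (∃ x ∈ e, x ∈ O) then 0 else w e)).real
          (openConn a b ∩ ⋃ s ∈ S, ⋃ x ∈ A, openConn s x) ≤
        (prodBernoulli (fun e : Sym2 (Fin n) =>
          if (∀ x ∈ e, x ∈ S) ∧ ¬ e.IsDiag then 1 else if (∃ x ∈ e, x ∈ O) then 0 else w e)).real
          (⋃ s ∈ S, openConn s b)) :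
    (prodBernoulli (fun e : Sym2 (Fin n) => if (∀ x ∈ e, x ∈ O) ∧ ¬ e.IsDiag then 1 else w e)).real
        (openConn a b ∩ ⋃ o ∈ O, ⋃ x ∈ A, openConn o x) ≤
      (prodBernoulli (fun e : Sym2 (Fin n) => if (∀ x ∈ e, x ∈ O) ∧ ¬ e.IsDiag then 1 else w e)).real
        (⋃ o ∈ O, openConn o b) := by
  classical
  set g : Sym2 (Fin n) → unitInterval := fun e => if (∀ x ∈ e, x ∈ O) ∧ ¬ e.IsDiag then 1 else w e with hg
  set k : Sym2 (Fin n) → unitInterval := fun e => if (∃ x ∈ e, x ∈ O) then 0 else w e with hk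
  -- layer decomposition of both sides
  rw [sigmaRec_partition g O (openConn a b ∩ _), sigmaRec_partition g O (⋃ o ∈ O, openConn o b)]
  refine Finset.sum_le_sum fun S _ => ?_
  set L : Set (BondConfig (Fin n)) := {ω | ∀ x : Fin n, x ∈ S ↔ (x ∉ O ∧ ∃ o ∈ O, s(o, x) ∈ ω)} with hL
  set Ψ : BondConfig (Fin n) → BondConfig (Fin n) := fun ω =>
    ({e | e ∈ ω ∧ ∀ x ∈ e, x ∉ O} ∪ {e | (∀ x ∈ e, x ∈ S) ∧ ¬ e.IsDiag} : BondConfig (Fin n)) with hΨ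
  set gS : Sym2 (Fin n) → unitInterval := fun e =>
    if (∀ x ∈ e, x ∈ S) ∧ ¬ e.IsDiag then 1 else if (∃ x ∈ e, x ∈ O) then 0 else w e with hgS
  -- internal pairs of `O` are a.s. open under the glued weights
  set K : Set (BondConfig (Fin n)) := {ω | ∀ o ∈ O, ∀ o' ∈ O, o ≠ o' → s(o, o') ∈ ω} with hK
  have hKc : prodBernoulli g Kᶜ = 0 := by
    refine sigmaRec_conull g K fun ω hω => ?_
    simp only [hK, mem_setOf_eq, not_forall] at hω
    obtain ⟨o, ho, o', ho', hne, hclosed⟩ := hω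
    refine ⟨s(o, o'), ?_, hclosed⟩
    simp only [hg]
    rw [if_pos ⟨fun x hx => by rcases Sym2.mem_iff.1 hx with rfl | rfl <;> assumption,
      by rw [Sym2.mk_isDiag_iff]; exact hne⟩]
  -- geometry on `L ∩ K`
  have hgeomA : ∀ ω, ω ∈ L → ω ∈ K →
      (ω ∈ (openConn a b ∩ ⋃ o ∈ O, ⋃ x ∈ A, openConn o x : Set (BondConfig (Fin n))) ↔
        ω ∈ Ψ ⁻¹' (openConn a b ∩ ⋃ s ∈ S, ⋃ x ∈ A, openConn s x)) := by
    intro ω hωL hωK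
    obtain ⟨h1, h2⟩ := stub_sigmaGeometry n O S ω hωL hωK
    simp only [mem_preimage, mem_inter_iff]
    exact and_congr (h2 a b haO hbO) (h1 A hOA)
  have hgeomB : ∀ ω, ω ∈ L → ω ∈ K →
      (ω ∈ (⋃ o ∈ O, openConn o b : Set (BondConfig (Fin n))) ↔ ω ∈ Ψ ⁻¹' (⋃ s ∈ S, openConn s b)) := by
    intro ω hωL hωK
    obtain ⟨h1, -⟩ := stub_sigmaGeometry n O S ω hωL hωK
    have hOb : Disjoint O {b} := Finset.disjoint_singleton_right.2 hbO
    have := h1 {b} hOb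
    simp only [Finset.mem_singleton, iUnion_iUnion_eq_left] at this
    simpa only [mem_preimage] using this
  -- null layers: some `x ∈ S` receives no positive pair from `O` (in particular `x ∈ O`)
  by_cases hgen : ∀ x ∈ S, x ∉ O ∧ ∃ o ∈ O, w s(o, x) ≠ 0
  swap
  · have hL0 : (prodBernoulli g).real L = 0 := by
      push Not at hgen
      obtain ⟨x, hxS, hx⟩ := hgen
      by_cases hxO : x ∈ O
      · have hLe : L = ∅ := by
          ext ω
          simp only [hL, mem_setOf_eq, mem_empty_iff_false, iff_false]
          intro h
          exact ((h x).1 hxS).1 hxO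
        rw [hLe, measureReal_empty]
      · refine sigmaRec_null g L (O.image fun o => s(o, x)) (fun e he => ?_) (fun ω hω => ?_)
        · obtain ⟨o, ho, rfl⟩ := Finset.mem_image.1 he
          have hw0 : w s(o, x) = 0 := hx hxO o ho
          have hnot : ¬ ((∀ y ∈ s(o, x), y ∈ O) ∧ ¬ (s(o, x)).IsDiag) := fun h =>
            hxO (h.1 x (Sym2.mem_mk_right o x))
          simp only [hg]
          rw [if_neg hnot, hw0]
        · obtain ⟨-, o, ho, hox⟩ := ((hω : ω ∈ L) x |>.1) hxS
          exact ⟨s(o, x), Finset.mem_image.2 ⟨o, ho, rfl⟩, hox⟩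
    calc (prodBernoulli g).real (L ∩ (openConn a b ∩ ⋃ o ∈ O, ⋃ x ∈ A, openConn o x))
        ≤ (prodBernoulli g).real L := measureReal_mono inter_subset_left
      _ = 0 := hL0
      _ ≤ _ := measureReal_nonneg
  rw [sigmaRec_inter_congr g hKc hgeomA, sigmaRec_inter_congr g hKc hgeomB]
  -- the empty layer: `O` is isolated, the left event is empty
  rcases S.eq_empty_or_nonempty with hSe | hSne
  · have h0 : Ψ ⁻¹' (openConn a b ∩ ⋃ s ∈ S, ⋃ x ∈ A, (openConn s x : Set (BondConfig (Fin n)))) = ∅ := by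
      rw [hSe]; ext ω; simp
    rw [h0, inter_empty, measureReal_empty]
    exact measureReal_nonneg
  -- the layer law
  have hlawA := stub_sigmaLaw n w O S (openConn a b ∩ ⋃ s ∈ S, ⋃ x ∈ A, openConn s x)
  have hlawB := stub_sigmaLaw n w O S (⋃ s ∈ S, openConn s b)
  change (prodBernoulli g).real (L ∩ Ψ ⁻¹' _) = (prodBernoulli g).real L * (prodBernoulli gS).real _ at hlawA
  change (prodBernoulli g).real (L ∩ Ψ ⁻¹' _) = (prodBernoulli g).real L * (prodBernoulli gS).real _ at hlawB
  rw [hlawA, hlawB]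
  refine mul_le_mul_of_nonneg_left ?_ measureReal_nonneg
  -- the layer inequality in the world `glue_S (kill_O w)`
  by_cases hbS : b ∈ S
  · have h1 : (prodBernoulli gS).real (⋃ s ∈ S, openConn s b) = 1 := by
      have : (⋃ s ∈ S, openConn s b : Set (BondConfig (Fin n))) = univ :=
        eq_univ_of_forall fun ω => mem_iUnion₂.2
          ⟨b, hbS, (SimpleGraph.Reachable.refl b : (openGraph ω).Reachable b b)⟩
      rw [this, probReal_univ]
    rw [h1]; exact measureReal_le_one
  by_cases hSA : ∃ v ∈ S, v ∈ A
  · -- a layer meeting `A`: Kozma–Nitzan Lemma 5 with the relay `v ∈ S`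
    obtain ⟨v, hvS, hvA⟩ := hSA
    obtain ⟨-, hport⟩ := hgen v hvS
    have h5 := stub_gluingLemma5 n k S a v b hvS hbS (hdom v hvA hport)
    exact (measureReal_mono inter_subset_left).trans h5
  · -- a relay-free (Steiner) layer: the hypothesis for the glued layer
    push Not at hSA
    have hSdisj : Disjoint S A := Finset.disjoint_left.2 fun x hxS hxA => hSA x hxS hxA
    exact hsteiner S hSne hSdisj hgen

/-- **Layer lemma with transfer.**  As `blockQ9_layer`, but on each Steiner layer `S` the inequality (41) may be
supplied for ANOTHER anchor `a'` together with the transfer comparison `μ(a ↔ b, S ↔ A) ≤ μ(a' ↔ b, S ↔ A)` in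
`glue_S (kill_O w)` (cf. `blockQ9_of_transfer`).  This is the induction step of the layered certificate.
[cite: KozmaNitzan2024, Lemma 5 and Theorems 4–5 (pp. 12–14)] -/
theorem blockQ9_layer_transfer (w : Sym2 (Fin n) → unitInterval) (O A : Finset (Fin n)) (a b : Fin n)
    (hOA : Disjoint O A) (haO : a ∉ O) (hbO : b ∉ O)
    (hdom : ∀ v ∈ A, (∃ o ∈ O, w s(o, v) ≠ 0) →
      (prodBernoulli (fun e : Sym2 (Fin n) => if (∃ x ∈ e, x ∈ O) then 0 else w e)).real (openConn a b) ≤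
        (prodBernoulli (fun e : Sym2 (Fin n) => if (∃ x ∈ e, x ∈ O) then 0 else w e)).real (openConn v b))
    (hsteiner : ∀ S : Finset (Fin n), S.Nonempty → Disjoint S A →
      (∀ x ∈ S, x ∉ O ∧ ∃ o ∈ O, w s(o, x) ≠ 0) → ∃ a' : Fin n,
      (prodBernoulli (fun e : Sym2 (Fin n) =>
          if (∀ x ∈ e, x ∈ S) ∧ ¬ e.IsDiag then 1 else if (∃ x ∈ e, x ∈ O) then 0 else w e)).real
          (openConn a b ∩ ⋃ s ∈ S, ⋃ x ∈ A, openConn s x) ≤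
        (prodBernoulli (fun e : Sym2 (Fin n) =>
          if (∀ x ∈ e, x ∈ S) ∧ ¬ e.IsDiag then 1 else if (∃ x ∈ e, x ∈ O) then 0 else w e)).real
          (openConn a' b ∩ ⋃ s ∈ S, ⋃ x ∈ A, openConn s x) ∧
      (prodBernoulli (fun e : Sym2 (Fin n) =>
          if (∀ x ∈ e, x ∈ S) ∧ ¬ e.IsDiag then 1 else if (∃ x ∈ e, x ∈ O) then 0 else w e)).real
          (openConn a' b ∩ ⋃ s ∈ S, ⋃ x ∈ A, openConn s x) ≤
        (prodBernoulli (fun e : Sym2 (Fin n) =>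
          if (∀ x ∈ e, x ∈ S) ∧ ¬ e.IsDiag then 1 else if (∃ x ∈ e, x ∈ O) then 0 else w e)).real
          (⋃ s ∈ S, openConn s b)) :
    (prodBernoulli (fun e : Sym2 (Fin n) => if (∀ x ∈ e, x ∈ O) ∧ ¬ e.IsDiag then 1 else w e)).real
        (openConn a b ∩ ⋃ o ∈ O, ⋃ x ∈ A, openConn o x) ≤
      (prodBernoulli (fun e : Sym2 (Fin n) => if (∀ x ∈ e, x ∈ O) ∧ ¬ e.IsDiag then 1 else w e)).real
        (⋃ o ∈ O, openConn o b) := by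
  refine blockQ9_layer w O A a b hOA haO hbO hdom fun S hS hSA hgen => ?_
  obtain ⟨a', htr, h41⟩ := hsteiner S hS hSA hgen
  exact htr.trans h41

/-- **Root form for a single observer vertex `o ∉ A`** (`a, b ≠ o`): if `a` is dominated in `G − o` by every relay
neighbour of `o` and (41) with anchor `a` holds for every glued Steiner layer of `o` in `glue_S (G − o)`, then
Kozma–Nitzan's inequality (41) holds at `o`:  `μ_w(a ↔ b, o ↔ A) ≤ μ_w(o ↔ b)`.  (No Steiner neighbours: their
Theorem 4 with its global minimiser, i.e. Question 9 for a one-layer observer; one Steiner neighbour: Theorem 5.)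
[cite: KozmaNitzan2024, Theorems 4–5 (pp. 12–14), Question 9 (p. 36)] -/
theorem q9_layer (w : Sym2 (Fin n) → unitInterval) (A : Finset (Fin n)) (o a b : Fin n)
    (hoA : o ∉ A) (hao : a ≠ o) (hbo : b ≠ o)
    (hdom : ∀ v ∈ A, w s(o, v) ≠ 0 →
      (prodBernoulli (fun e : Sym2 (Fin n) => if o ∈ e then 0 else w e)).real (openConn a b) ≤
        (prodBernoulli (fun e : Sym2 (Fin n) => if o ∈ e then 0 else w e)).real (openConn v b))
    (hsteiner : ∀ S : Finset (Fin n), S.Nonempty → Disjoint S A → (∀ x ∈ S, x ≠ o ∧ w s(o, x) ≠ 0) →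
      (prodBernoulli (fun e : Sym2 (Fin n) =>
          if (∀ x ∈ e, x ∈ S) ∧ ¬ e.IsDiag then 1 else if o ∈ e then 0 else w e)).real
          (openConn a b ∩ ⋃ s ∈ S, ⋃ x ∈ A, openConn s x) ≤
        (prodBernoulli (fun e : Sym2 (Fin n) =>
          if (∀ x ∈ e, x ∈ S) ∧ ¬ e.IsDiag then 1 else if o ∈ e then 0 else w e)).real
          (⋃ s ∈ S, openConn s b)) :
    (prodBernoulli w).real (openConn a b ∩ ⋃ x ∈ A, openConn o x) ≤ (prodBernoulli w).real (openConn o b) := by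
  classical
  have hmem : ∀ e : Sym2 (Fin n), (∃ x ∈ e, x ∈ ({o} : Finset (Fin n))) ↔ o ∈ e := fun e =>
    ⟨fun ⟨x, hx, hxo⟩ => (Finset.mem_singleton.1 hxo) ▸ hx, fun h => ⟨o, h, Finset.mem_singleton_self o⟩⟩
  have hk : (fun e : Sym2 (Fin n) => if (∃ x ∈ e, x ∈ ({o} : Finset (Fin n))) then (0 : unitInterval) else w e) =
      fun e : Sym2 (Fin n) => if o ∈ e then 0 else w e := by
    funext e; simp only [hmem]
  have hOA : Disjoint ({o} : Finset (Fin n)) A := Finset.disjoint_singleton_left.2 hoA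
  have haO : a ∉ ({o} : Finset (Fin n)) := fun h => hao (Finset.mem_singleton.1 h)
  have hbO : b ∉ ({o} : Finset (Fin n)) := fun h => hbo (Finset.mem_singleton.1 h)
  have key := blockQ9_layer w {o} A a b hOA haO hbO ?_ ?_
  · rw [goodStep24_glue_singleton] at key
    simpa only [Finset.mem_singleton, iUnion_iUnion_eq_left] using key
  · intro v hvA ⟨o', ho', hw⟩
    rw [Finset.mem_singleton.1 ho'] at hw
    rw [hk]
    exact hdom v hvA hw
  · intro S hS hSA hgen
    have hgen' : ∀ x ∈ S, x ≠ o ∧ w s(o, x) ≠ 0 := by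
      intro x hx
      obtain ⟨hxo, o', ho', hw⟩ := hgen x hx
      rw [Finset.mem_singleton.1 ho'] at hw
      exact ⟨fun h => hxo (Finset.mem_singleton.2 h), hw⟩
    have hgS : (fun e : Sym2 (Fin n) => if (∀ x ∈ e, x ∈ S) ∧ ¬ e.IsDiag then (1 : unitInterval) else
        if (∃ x ∈ e, x ∈ ({o} : Finset (Fin n))) then 0 else w e) =
        fun e : Sym2 (Fin n) => if (∀ x ∈ e, x ∈ S) ∧ ¬ e.IsDiag then 1 else if o ∈ e then 0 else w e := by
      funext e; simp only [hmem]
    rw [hgS]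
    exact hsteiner S hS hSA hgen'

end BlockQ9

end

end Summit.CriticalPhenomena.PercolationContinuityZ3.Theorems
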